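import Summits.BirchSwinnertonDyer.Rank1Residual.Supersingular.SharpFlatRankZeroReal
import Literature.NumberTheory.EllipticCurves.Sprung2017.SharpFlatPAdicLFunctionProofs
import Literature.NumberTheory.EllipticCurves.ModularCurvePeriodRatio
import Literature.NumberTheory.EllipticCurves.ModularCurve
import HarnessLib

/-!
# Route `SignedLowerHalves`, crux `SprungLowerHalfAtThree` (item stmt-BirchSwinnertonDyer-19003): the
# registered stub `stub_sprungPair` (the REAL OBJECTS of an X8 pair) CLOSED MODULO two PUBLISHED named
# facts — modularity and the `3`-adic period-ratio unit — Sprung's pair being a tree THEOREM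
# (cell `bsd-ssimc`, seat `bsd-ssimc-k3-c5` gen 0; a `--supports … --as helper` file, closes nothing)

PARTITION (cell bsd-ssimc): X8 (A8) — the class `p = 3`, good supersingular, `a_3 = ±3`, at EVERY analytic
rank (crux 5 is typed rank-free) — types-the-object-of; closes NONE. THEOREMS ONLY; nothing is booked.

Stub (A) of the BC3 skeleton `Cruxes/SprungLowerHalfAtThree/Lines/birth.lean` (planner g10, REGISTERED,
skeleton sha `c0fa77bad7ad`) asks, for every X8 pair `(W, 3)`: a level `N`, a newform `f ∈ S₂(Γ₀(N))` of `W`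
(`IsNewformOf W f`), the period ratio `ϖ ∈ ℚ` with `ϖ · Ω_W = Ω⁺_f`, and a Sprung pair `(L♯, L♭) ∈ Λ²` for
`(f, 3, a_3(W))` (`Sprung2017.IsSprungPair`). The stub has NO hypothesis slot, so an unconditional proof
would need the Modularity Theorem as a tree THEOREM; it is a named fact (D-0014). This file proves the stub's
conclusion from exactly the published inputs the route's support item `PublishedSignedInputs` already lists:

* modularity — EITHER `ModularForms.exists_isNewformOf` (Breuil–Conrad–Diamond–Taylor 2001 Thm. A /
  Diamond–Shurman Thm. 8.8.3, the existence half; weakest form) OR the support item's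
  `ModularForms.nonempty_modularParametrizationData` (which carries the newform as a field);
* the period ratio — `realPeriodRat_eq_unit_mul_plusPeriod_three` (Greenberg–Vatsal 2000 §3 Rem. 3.4 +
  Mazur 1978 Cor. 4.1 + Edixhoven 1991 Prop. 2: `Ω_W = u · Ω⁺_f`, `u ∈ ℚ`, `|u|_3 = 1`, at a good prime `3`
  with `E[3]` irreducible — automatic on X8, `ClassX8.irr`); so `ϖ = u⁻¹` and `|ϖ|_3 = 1` is RECORDED
  (the divisibility stub (B) needs the `3`-integrality of `ϖ`, see the companion reduction file);
* Sprung 2017 Thm. 1.12 in Mazur–Tate form — a THEOREM of the tree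
  (`Sprung2017.thm112_exists_isSprungPair_holds`, file `Sprung2017/SharpFlatPAdicLFunctionProofs.lean`),
  applicable because on X8 `3` is odd, good, and `3 ∣ a_3`.

So stub (A) is «closed modulo modularity + the Manin/period unit at 3», both refereed print; the crux item
stays OPEN on the ledger (its own signature is not proved here).

References: [Sprung2017] Thm. 1.12, Cor. 4.4–4.5, 4.10–4.11; [DiamondShurman2005] Thm. 8.8.3;
[BCDTJAMS2001] Thm. A; [GreenbergVatsal2000] §3 Rem. 3.4; [Mazur1978] Cor. 4.1; [EdixhovenManin1991] Prop. 2.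
-/

set_option autoImplicit false
set_option linter.dupNamespace false

noncomputable section

open scoped Classical MatrixGroups ModularForm

open CongruenceSubgroup WeierstrassCurve Literature.NumberTheory.EllipticCurves
  Literature.NumberTheory.EllipticCurves.ModularForms
  Literature.NumberTheory.EllipticCurves.Rank1Residual
  Literature.NumberTheory.EllipticCurves.Sprung2017
  Summit.BirchSwinnertonDyer.Rank1Residual.Supersingular

namespace Summit.BirchSwinnertonDyer.BirchSwinnertonDyer.Theorems

/-- **The real objects of an X8 pair, for a GIVEN newform** (core form). On class X8 (`p = 3`, good
supersingular, `a_3 = ±3`), granted the period-ratio fact at `3` (`hper`, Greenberg–Vatsal Rem. 3.4 with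
Mazur's Manin-constant corollary), for `f ∈ S₂(Γ₀(N))` the newform of `W`: the period ratio `ϖ ∈ ℚ` with
`ϖ · Ω_W = Ω⁺_f` exists and is a `3`-adic unit (`ϖ = u⁻¹`), and a Sprung pair `(L♯, L♭)` for `(f, 3, a_3)`
exists by the tree theorem `thm112_exists_isSprungPair_holds` (`3` odd, good, `3 ∣ a_3`).
CONDITIONAL on `hper` only. [cite: GreenbergVatsal2000, §3 Remark 3.4] [cite: Mazur1978, Cor. 4.1]
[cite: Sprung2017, Thm. 1.12 and Cor. 4.4] -/
theorem X8_periodRatio_and_sprungPair_of_isNewformOf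
    (hper : realPeriodRat_eq_unit_mul_plusPeriod_three)
    (W : WeierstrassCurve ℚ) [W.IsElliptic] [W.IsGloballyMinimal] (p : ℕ) [Fact p.Prime]
    (hX : ClassX8 W p) {N : ℕ} [NeZero N] (f : CuspForm (Gamma0 N) 2) (hf : IsNewformOf W f) :
    ∃ (ϖ : ℚ) (Lsharp Lflat : IwasawaAlgebra p),
      (ϖ : ℝ) * W.realPeriodRat = plusPeriod f ∧ ‖(ϖ : ℚ_[p])‖ = 1 ∧
        IsSprungPair f p (W.frobeniusTrace p) Lsharp Lflat := by
  have hp3 : p = 3 := hX.1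
  subst hp3
  have hgood : W.HasGoodReductionAtPrime 3 := hX.2.1.1
  have hdvd : ((3 : ℕ) : ℤ) ∣ W.frobeniusTrace 3 := hX.2.1.2
  have hirr : W.HasIrreducibleModPGaloisRep 3 := ClassX8.irr W 3 hX
  obtain ⟨u, hu1, hΩ⟩ := hper W hgood hirr f hf
  have hu0 : u ≠ 0 := by
    intro h0
    rw [h0, Rat.cast_zero, norm_zero] at hu1
    exact zero_ne_one hu1
  obtain ⟨Lsharp, Lflat, hSP⟩ :=
    thm112_exists_isSprungPair_holds (W := W) (f := f) (p := 3) (by decide) hf hgood hdvd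
  refine ⟨u⁻¹, Lsharp, Lflat, ?_, ?_, hSP⟩
  · rw [hΩ, Rat.cast_inv, ← mul_assoc, inv_mul_cancel₀ (Rat.cast_ne_zero.mpr hu0), one_mul]
  · rw [Rat.cast_inv, norm_inv, hu1, inv_one]

/-- **`stub_sprungPair` (verbatim header) MODULO modularity and the period-ratio unit at `3`.** With
`hmod : exists_isNewformOf` (the Modularity Theorem, existence half: a newform of level `N_W` with
`aₙ(f) = aₙ(W)`; `N_W ≥ 1` by the tree theorem `conductorNorm_pos_holds`) and
`hper : realPeriodRat_eq_unit_mul_plusPeriod_three`, every X8 pair has the real objects of crux 5's clause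
(A): newform, period ratio, Sprung pair. The statement after the two binders is the registered stub
`Summit.…Cruxes.SprungLowerHalfAtThree.Birth.stub_sprungPair` VERBATIM. CONDITIONAL; closes nothing.
[cite: DiamondShurman2005, Thm. 8.8.3] [cite: GreenbergVatsal2000, §3 Remark 3.4]
[cite: Sprung2017, Thm. 1.12 and Cor. 4.4] -/
theorem stub_sprungPair_of_modularity_of_periodUnit (hmod : exists_isNewformOf)
    (hper : realPeriodRat_eq_unit_mul_plusPeriod_three) :
    ∀ (W : WeierstrassCurve ℚ) [W.IsElliptic] [W.IsGloballyMinimal] (p : ℕ) [Fact p.Prime],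
      Literature.NumberTheory.EllipticCurves.Rank1Residual.ClassX8 W p →
      ∃ (N : ℕ) (_ : NeZero N) (f : CuspForm (CongruenceSubgroup.Gamma0 N) 2) (ϖ : ℚ)
        (Lsharp Lflat : Literature.NumberTheory.EllipticCurves.IwasawaAlgebra p),
        Literature.NumberTheory.EllipticCurves.ModularForms.IsNewformOf W f ∧
        (ϖ : ℝ) * W.realPeriodRat = Literature.NumberTheory.EllipticCurves.ModularForms.plusPeriod f ∧
        Literature.NumberTheory.EllipticCurves.Sprung2017.IsSprungPair f p (W.frobeniusTrace p)
          Lsharp Lflat := by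
  intro W _ _ p _ hX
  haveI hN : NeZero (W.conductorNorm ℤ) := ⟨(W.conductorNorm_pos_holds).ne'⟩
  obtain ⟨f, hf⟩ := hmod W
  obtain ⟨ϖ, Lsharp, Lflat, hϖ, -, hSP⟩ := X8_periodRatio_and_sprungPair_of_isNewformOf hper W p hX f hf
  exact ⟨W.conductorNorm ℤ, hN, f, ϖ, Lsharp, Lflat, hf, hϖ, hSP⟩

/-- **`stub_sprungPair` (verbatim header) MODULO the support item's modularity fact
`nonempty_modularParametrizationData` and the period-ratio unit at `3`** — the form that plugs into the
route's `PublishedSignedInputs` as listed (the parametrization datum carries the newform `D.f` with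
`D.isNewformOf`). CONDITIONAL; closes nothing. [cite: BCDTJAMS2001, Thm. A]
[cite: GreenbergVatsal2000, §3 Remark 3.4] [cite: Sprung2017, Thm. 1.12 and Cor. 4.4] -/
theorem stub_sprungPair_of_modularParametrization_of_periodUnit
    (hmodP : nonempty_modularParametrizationData)
    (hper : realPeriodRat_eq_unit_mul_plusPeriod_three) :
    ∀ (W : WeierstrassCurve ℚ) [W.IsElliptic] [W.IsGloballyMinimal] (p : ℕ) [Fact p.Prime],
      Literature.NumberTheory.EllipticCurves.Rank1Residual.ClassX8 W p →
      ∃ (N : ℕ) (_ : NeZero N) (f : CuspForm (CongruenceSubgroup.Gamma0 N) 2) (ϖ : ℚ)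
        (Lsharp Lflat : Literature.NumberTheory.EllipticCurves.IwasawaAlgebra p),
        Literature.NumberTheory.EllipticCurves.ModularForms.IsNewformOf W f ∧
        (ϖ : ℝ) * W.realPeriodRat = Literature.NumberTheory.EllipticCurves.ModularForms.plusPeriod f ∧
        Literature.NumberTheory.EllipticCurves.Sprung2017.IsSprungPair f p (W.frobeniusTrace p)
          Lsharp Lflat := by
  intro W _ _ p _ hX
  haveI hN : NeZero (W.conductorNorm ℤ) := ⟨(W.conductorNorm_pos_holds).ne'⟩
  obtain ⟨D⟩ := hmodP W
  obtain ⟨ϖ, Lsharp, Lflat, hϖ, -, hSP⟩ :=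
    X8_periodRatio_and_sprungPair_of_isNewformOf hper W p hX D.f D.isNewformOf
  exact ⟨W.conductorNorm ℤ, hN, D.f, ϖ, Lsharp, Lflat, D.isNewformOf, hϖ, hSP⟩

end Summit.BirchSwinnertonDyer.BirchSwinnertonDyer.Theorems

end
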